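import Summits.RiemannHypothesis.RiemannHypothesis.Theorems.HandoffAnalytic
import Summits.RiemannHypothesis.RiemannHypothesis.Theorems.HandoffDecomposition
import HarnessLib

/-!
# HANDOFF — the ONE-SECTOR ladders as kernel sentences (cell rh-explicit, TRACK «HANDOFF», seat theory-2 gen8, file XII-u; companion of XII-s `HandoffSectorCriterion`)

HONEST FRAMING. Nothing here bears on the truth of RH; no certificate is proved. XII-s (`HandoffSectorCriterion`, p381376) proves that the EVEN
halves `H_ev(q) :≡ 0 ≤ ε_ev((log q⁺)/2)` of the handoff inequalities (and likewise the ODD halves) form, as an infinite family, a statement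
equivalent to RH, and gives the one-sector ladder rule. This file (which does not import XII-s — not yet built on the farm — and re-derives the
three-line rule inline) turns the cell's EVEN-ONLY / ODD-ONLY ladder words into kernel sentences, exactly as `HandoffLadderRungs` /
`HandoffLadderRungsWide` do for the two-sector ladder:

* downward closure in one sector: «`H_ev(q)` for all primes `q ≤ Q`» ↔ `H_ev(Q)` (`forall_even_le_iff`, `forall_odd_le_iff`);
* the rows (kernel arithmetic `P^k ≤ e^m`, `log_half_le_of_pow_le`; `nextPrime_values`):
  `0 ≤ ε_ev(17/10)` ⟹ `H_ev(q)` ∀ primes `q ≤ 23` · `0 ≤ ε_ev(7/4)` ⟹ `q ≤ 29` · `0 ≤ ε_ev(2)` ⟹ `q ≤ 47` · `0 ≤ ε_ev(11/5)` ⟹ `q ≤ 73` (T2's list in the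
  even sector), and the odd twins at `7/4` and `2`.

DATA reading (the cell's, used in no proof): by theory-2's ladder harvest of 2026-08-24T11:46Z the even cells at `17/10` and `7/4` (w4) are
custodian-VERIFIED while the odd ones are producer-CLAIMED, so `forall_even_le_29_of_even_energy_7_4` makes «`H_ev(q)` for all primes `q ≤ 29`»
CERTIFIED single-lineage VERIFIED today, two rungs beyond the two-sector ladder's custodian-verified reach; a two-sector `t = 2` cell would give both
sectors through `q = 47` (`HandoffLadderRungs.forall_handoffH_of_sector_energies_two`), an even `t = 2` N = ∞ bracket alone already `H_ev` through 47.
The finite segments are interfaces for certificates; only the infinite families are RH (XII-s).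

References: E. Bombieri, Rend. Mat. Acc. Lincei (9) 11 (2000) §4 Thm 5 (p. 199: μ±(M) decreasing) [Bombieri2000Weil]; H. Yoshida, Adv. Stud.
Pure Math. 21 (1992) Prop. 1 (1)/(2) (parity criteria), Prop. 6 (p. 320) [Yoshida1992HermitianForms].
-/

set_option linter.dupNamespace false

noncomputable section

open Set Literature.NumberTheory.LFunctions
open Summit.RiemannHypothesis.RiemannHypothesis.Theorems.HandoffDecomposition

namespace Summit.RiemannHypothesis.RiemannHypothesis.Theorems.HandoffSectorLadder

variable {q Q : ℕ} {c : ℝ}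

/-! ## §1 One-sector downward closure -/

/-- Window ends are monotone and positive: for primes `q ≤ Q`, `0 < (log q⁺)/2 ≤ (log Q⁺)/2`. [folklore] -/
theorem log_nextPrime_half_pos_and_mono (hQ : Q.Prime) (hqQ : q ≤ Q) :
    0 < Real.log (nextPrime q) / 2 ∧ Real.log (nextPrime q) / 2 ≤ Real.log (nextPrime Q) / 2 := by
  have hmono : nextPrime q ≤ nextPrime Q := by
    rcases hqQ.eq_or_lt with rfl | hlt
    · exact le_rfl
    · exact (nextPrime_le hQ hlt).trans (lt_nextPrime Q).le
  have h0 : (1 : ℝ) < nextPrime q := by exact_mod_cast (nextPrime_prime q).one_lt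
  have h1 : (nextPrime q : ℝ) ≤ nextPrime Q := by exact_mod_cast hmono
  have := Real.log_pos h0
  exact ⟨by positivity, by linarith [Real.log_le_log (by linarith) h1]⟩

/-- **EVEN LADDER RULE** (as in XII-s, re-derived): one even certificate `0 ≤ ε_ev(c)` at `c ≥ (log Q⁺)/2` gives `H_ev(q)` for every prime `q ≤ Q`,
stated with the conclusion as the finite even segment. [cite: Bombieri2000Weil, §4 Thm 5 (p. 199)] -/
theorem evenSegment_of_even_energy (hQ : Q.Prime) (hc : Real.log (nextPrime Q) / 2 ≤ c) (hev : 0 ≤ weilEvenGroundEnergy c)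
    (hqQ : q ≤ Q) : 0 ≤ weilEvenGroundEnergy (Real.log (nextPrime q) / 2) := by
  obtain ⟨h0, hm⟩ := log_nextPrime_half_pos_and_mono hQ hqQ
  exact hev.trans (weilEvenGroundEnergy_antitone h0 (hm.trans hc))

/-- **ODD LADDER RULE** (twin). [cite: Bombieri2000Weil, §4 Thm 5 (p. 199)] -/
theorem oddSegment_of_odd_energy (hQ : Q.Prime) (hc : Real.log (nextPrime Q) / 2 ≤ c) (hod : 0 ≤ weilOddGroundEnergy c)
    (hqQ : q ≤ Q) : 0 ≤ weilOddGroundEnergy (Real.log (nextPrime q) / 2) := by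
  obtain ⟨h0, hm⟩ := log_nextPrime_half_pos_and_mono hQ hqQ
  exact hod.trans (weilOddGroundEnergy_antitone h0 (hm.trans hc))

/-- Downward closure in the even sector: «`H_ev(q)` for all primes `q ≤ Q`» ↔ `H_ev(Q)` (`Q` prime). [cite: Bombieri2000Weil, §4 Thm 5 (p. 199)] -/
theorem forall_even_le_iff (hQ : Q.Prime) :
    (∀ q : ℕ, q.Prime → q ≤ Q → 0 ≤ weilEvenGroundEnergy (Real.log (nextPrime q) / 2)) ↔
      0 ≤ weilEvenGroundEnergy (Real.log (nextPrime Q) / 2) :=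
  ⟨fun h ↦ h Q hQ le_rfl, fun h _ _ hqQ ↦ evenSegment_of_even_energy hQ le_rfl h hqQ⟩

/-- Downward closure in the odd sector. [cite: Bombieri2000Weil, §4 Thm 5 (p. 199)] -/
theorem forall_odd_le_iff (hQ : Q.Prime) :
    (∀ q : ℕ, q.Prime → q ≤ Q → 0 ≤ weilOddGroundEnergy (Real.log (nextPrime q) / 2)) ↔
      0 ≤ weilOddGroundEnergy (Real.log (nextPrime Q) / 2) :=
  ⟨fun h ↦ h Q hQ le_rfl, fun h _ _ hqQ ↦ oddSegment_of_odd_energy hQ le_rfl h hqQ⟩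

/-! ## §2 Kernel arithmetic for the rows -/

/-- `P^k ≤ 2.7182818283^m` (`P, k ≥ 1`) gives `(log P)/2 ≤ m/(2k)`. [folklore] -/
theorem log_half_le_of_pow_le {P k m : ℕ} (hP : 1 ≤ P) (hk : 1 ≤ k)
    (h : (P : ℝ) ^ k ≤ (2.7182818283 : ℝ) ^ m) : Real.log P / 2 ≤ (m : ℝ) / (2 * k) := by
  have hP' : (0 : ℝ) < P := by exact_mod_cast hP
  have hk' : (0 : ℝ) < k := by exact_mod_cast hk
  have he : (2.7182818283 : ℝ) ^ m ≤ Real.exp m := by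
    rw [← Real.exp_one_pow]
    exact pow_le_pow_left₀ (by norm_num) Real.exp_one_gt_d9.le m
  have h1 : (P : ℝ) ^ k ≤ Real.exp m := h.trans he
  have h2 : (k : ℝ) * Real.log P ≤ m := by
    rw [← Real.log_pow]
    exact (Real.log_le_iff_le_exp (pow_pos hP' k)).2 h1
  rw [div_le_div_iff₀ two_pos (by positivity)]
  nlinarith

/-- `q⁺` for `q = 23, 29, 47, 73` is `29, 31, 53, 79`. [folklore] -/
theorem nextPrime_values : nextPrime 23 = 29 ∧ nextPrime 29 = 31 ∧ nextPrime 47 = 53 ∧ nextPrime 73 = 79 := by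
  refine ⟨?_, ?_, ?_, ?_⟩
  · refine le_antisymm (nextPrime_le (by norm_num) (by norm_num)) ?_
    have hp := nextPrime_prime 23
    have hl := lt_nextPrime 23
    by_contra hlt
    rw [not_le] at hlt
    generalize hx : nextPrime 23 = x at hp hl hlt
    interval_cases x <;> exact absurd hp (by norm_num)
  · refine le_antisymm (nextPrime_le (by norm_num) (by norm_num)) ?_
    have hp := nextPrime_prime 29
    have hl := lt_nextPrime 29
    by_contra hlt
    rw [not_le] at hlt
    generalize hx : nextPrime 29 = x at hp hl hlt
    interval_cases x; exact absurd hp (by norm_num)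
  · refine le_antisymm (nextPrime_le (by norm_num) (by norm_num)) ?_
    have hp := nextPrime_prime 47
    have hl := lt_nextPrime 47
    by_contra hlt
    rw [not_le] at hlt
    generalize hx : nextPrime 47 = x at hp hl hlt
    interval_cases x <;> exact absurd hp (by norm_num)
  · refine le_antisymm (nextPrime_le (by norm_num) (by norm_num)) ?_
    have hp := nextPrime_prime 73
    have hl := lt_nextPrime 73
    by_contra hlt
    rw [not_le] at hlt
    generalize hx : nextPrime 73 = x at hp hl hlt
    interval_cases x <;> exact absurd hp (by norm_num)

/-! ## §3 The rows -/

/-- **EVEN, row `17/10`**: `0 ≤ ε_ev(17/10)` gives `H_ev(q)` for every prime `q ≤ 23` (`29^5 ≤ e^{17}`). [this track] -/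
theorem forall_even_le_23_of_even_energy_17_10 (hev : 0 ≤ weilEvenGroundEnergy (17 / 10)) :
    ∀ q : ℕ, q.Prime → q ≤ 23 → 0 ≤ weilEvenGroundEnergy (Real.log (nextPrime q) / 2) := by
  intro q _ hqQ
  refine evenSegment_of_even_energy (by norm_num) ?_ hev hqQ
  rw [nextPrime_values.1]
  have := log_half_le_of_pow_le (P := 29) (k := 5) (m := 17) (by norm_num) (by norm_num) (by norm_num)
  norm_num at this ⊢; linarith

/-- **EVEN, row `7/4`**: `0 ≤ ε_ev(7/4)` gives `H_ev(q)` for every prime `q ≤ 29` (`31² ≤ e^7`). [this track] -/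
theorem forall_even_le_29_of_even_energy_7_4 (hev : 0 ≤ weilEvenGroundEnergy (7 / 4)) :
    ∀ q : ℕ, q.Prime → q ≤ 29 → 0 ≤ weilEvenGroundEnergy (Real.log (nextPrime q) / 2) := by
  intro q _ hqQ
  refine evenSegment_of_even_energy (by norm_num) ?_ hev hqQ
  rw [nextPrime_values.2.1]
  have := log_half_le_of_pow_le (P := 31) (k := 2) (m := 7) (by norm_num) (by norm_num) (by norm_num)
  norm_num at this ⊢; linarith

/-- **EVEN, row `2`**: `0 ≤ ε_ev(2)` gives `H_ev(q)` for every prime `q ≤ 47` (`53 ≤ e^4`). [this track] -/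
theorem forall_even_le_47_of_even_energy_two (hev : 0 ≤ weilEvenGroundEnergy 2) :
    ∀ q : ℕ, q.Prime → q ≤ 47 → 0 ≤ weilEvenGroundEnergy (Real.log (nextPrime q) / 2) := by
  intro q _ hqQ
  refine evenSegment_of_even_energy (by norm_num) ?_ hev hqQ
  rw [nextPrime_values.2.2.1]
  have := log_half_le_of_pow_le (P := 53) (k := 1) (m := 4) (by norm_num) (by norm_num) (by norm_num)
  norm_num at this ⊢; linarith

/-- **EVEN, row `11/5`**: `0 ≤ ε_ev(11/5)` gives `H_ev(q)` for every prime `q ≤ 73` (`79^5 ≤ e^{22}`) — T2's list, even sector. [this track] -/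
theorem forall_even_le_73_of_even_energy_11_5 (hev : 0 ≤ weilEvenGroundEnergy (11 / 5)) :
    ∀ q : ℕ, q.Prime → q ≤ 73 → 0 ≤ weilEvenGroundEnergy (Real.log (nextPrime q) / 2) := by
  intro q _ hqQ
  refine evenSegment_of_even_energy (by norm_num) ?_ hev hqQ
  rw [nextPrime_values.2.2.2]
  have := log_half_le_of_pow_le (P := 79) (k := 5) (m := 22) (by norm_num) (by norm_num) (by norm_num)
  norm_num at this ⊢; linarith

/-- **ODD, row `7/4`**: `0 ≤ ε_od(7/4)` gives `H_od(q)` for every prime `q ≤ 29`. [this track] -/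
theorem forall_odd_le_29_of_odd_energy_7_4 (hod : 0 ≤ weilOddGroundEnergy (7 / 4)) :
    ∀ q : ℕ, q.Prime → q ≤ 29 → 0 ≤ weilOddGroundEnergy (Real.log (nextPrime q) / 2) := by
  intro q _ hqQ
  refine oddSegment_of_odd_energy (by norm_num) ?_ hod hqQ
  rw [nextPrime_values.2.1]
  have := log_half_le_of_pow_le (P := 31) (k := 2) (m := 7) (by norm_num) (by norm_num) (by norm_num)
  norm_num at this ⊢; linarith

/-- **ODD, row `2`**: `0 ≤ ε_od(2)` gives `H_od(q)` for every prime `q ≤ 47`. [this track] -/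
theorem forall_odd_le_47_of_odd_energy_two (hod : 0 ≤ weilOddGroundEnergy 2) :
    ∀ q : ℕ, q.Prime → q ≤ 47 → 0 ≤ weilOddGroundEnergy (Real.log (nextPrime q) / 2) := by
  intro q _ hqQ
  refine oddSegment_of_odd_energy (by norm_num) ?_ hod hqQ
  rw [nextPrime_values.2.2.1]
  have := log_half_le_of_pow_le (P := 53) (k := 1) (m := 4) (by norm_num) (by norm_num) (by norm_num)
  norm_num at this ⊢; linarith


/-! ## §4 [gen9 append, 2026-08-24] The rows of the beyond-wall windows `17/10` (odd), `9/5`, `19/10`, `21/10`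

Custody addendum (theory-2 gen9; DATA reading used in no proof): by the ladder harvest of 2026-08-24T16:08Z (502 sector cells) the
w4 + weil-6 lineage holds EVEN N = ∞ brackets at `19/10` and `2` (producer-CLAIMED) and two-sector brackets at `7/4` and `9/5`; the rows
below are the one-sector kernel sentences those cells (and the next ones, `21/10`) instantiate. `31^5 ≤ e^{18}`, `43^5 ≤ e^{19}`,
`61^5 ≤ e^{21}`, `29^5 ≤ e^{17}`. -/

/-- `q⁺` for `q = 41, 59` is `43, 61`. [folklore] -/
theorem nextPrime_values' : nextPrime 41 = 43 ∧ nextPrime 59 = 61 := by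
  refine ⟨?_, ?_⟩
  · refine le_antisymm (nextPrime_le (by norm_num) (by norm_num)) ?_
    have hp := nextPrime_prime 41
    have hl := lt_nextPrime 41
    by_contra hlt
    rw [not_le] at hlt
    generalize hx : nextPrime 41 = x at hp hl hlt
    interval_cases x; exact absurd hp (by norm_num)
  · refine le_antisymm (nextPrime_le (by norm_num) (by norm_num)) ?_
    have hp := nextPrime_prime 59
    have hl := lt_nextPrime 59
    by_contra hlt
    rw [not_le] at hlt
    generalize hx : nextPrime 59 = x at hp hl hlt
    interval_cases x; exact absurd hp (by norm_num)

/-- **ODD, row `17/10`**: `0 ≤ ε_od(17/10)` gives `H_od(q)` for every prime `q ≤ 23` (`29^5 ≤ e^{17}`; the even twin is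
`forall_even_le_23_of_even_energy_17_10`). [this track] -/
theorem forall_odd_le_23_of_odd_energy_17_10 (hod : 0 ≤ weilOddGroundEnergy (17 / 10)) :
    ∀ q : ℕ, q.Prime → q ≤ 23 → 0 ≤ weilOddGroundEnergy (Real.log (nextPrime q) / 2) := by
  intro q _ hqQ
  refine oddSegment_of_odd_energy (by norm_num) ?_ hod hqQ
  rw [nextPrime_values.1]
  have := log_half_le_of_pow_le (P := 29) (k := 5) (m := 17) (by norm_num) (by norm_num) (by norm_num)
  norm_num at this ⊢; linarith

/-- **EVEN, row `9/5`**: `0 ≤ ε_ev(9/5)` gives `H_ev(q)` for every prime `q ≤ 29` (`31^5 ≤ e^{18}`; `37 > e^{18/5}` so not `31`). [this track] -/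
theorem forall_even_le_29_of_even_energy_9_5 (hev : 0 ≤ weilEvenGroundEnergy (9 / 5)) :
    ∀ q : ℕ, q.Prime → q ≤ 29 → 0 ≤ weilEvenGroundEnergy (Real.log (nextPrime q) / 2) := by
  intro q _ hqQ
  refine evenSegment_of_even_energy (by norm_num) ?_ hev hqQ
  rw [nextPrime_values.2.1]
  have := log_half_le_of_pow_le (P := 31) (k := 5) (m := 18) (by norm_num) (by norm_num) (by norm_num)
  norm_num at this ⊢; linarith

/-- **ODD, row `9/5`**: `0 ≤ ε_od(9/5)` gives `H_od(q)` for every prime `q ≤ 29`. [this track] -/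
theorem forall_odd_le_29_of_odd_energy_9_5 (hod : 0 ≤ weilOddGroundEnergy (9 / 5)) :
    ∀ q : ℕ, q.Prime → q ≤ 29 → 0 ≤ weilOddGroundEnergy (Real.log (nextPrime q) / 2) := by
  intro q _ hqQ
  refine oddSegment_of_odd_energy (by norm_num) ?_ hod hqQ
  rw [nextPrime_values.2.1]
  have := log_half_le_of_pow_le (P := 31) (k := 5) (m := 18) (by norm_num) (by norm_num) (by norm_num)
  norm_num at this ⊢; linarith

/-- **EVEN, row `19/10`**: `0 ≤ ε_ev(19/10)` gives `H_ev(q)` for every prime `q ≤ 41` (`43^5 ≤ e^{19}`). [this track] -/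
theorem forall_even_le_41_of_even_energy_19_10 (hev : 0 ≤ weilEvenGroundEnergy (19 / 10)) :
    ∀ q : ℕ, q.Prime → q ≤ 41 → 0 ≤ weilEvenGroundEnergy (Real.log (nextPrime q) / 2) := by
  intro q _ hqQ
  refine evenSegment_of_even_energy (by norm_num) ?_ hev hqQ
  rw [nextPrime_values'.1]
  have := log_half_le_of_pow_le (P := 43) (k := 5) (m := 19) (by norm_num) (by norm_num) (by norm_num)
  norm_num at this ⊢; linarith

/-- **ODD, row `19/10`**: `0 ≤ ε_od(19/10)` gives `H_od(q)` for every prime `q ≤ 41`. [this track] -/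
theorem forall_odd_le_41_of_odd_energy_19_10 (hod : 0 ≤ weilOddGroundEnergy (19 / 10)) :
    ∀ q : ℕ, q.Prime → q ≤ 41 → 0 ≤ weilOddGroundEnergy (Real.log (nextPrime q) / 2) := by
  intro q _ hqQ
  refine oddSegment_of_odd_energy (by norm_num) ?_ hod hqQ
  rw [nextPrime_values'.1]
  have := log_half_le_of_pow_le (P := 43) (k := 5) (m := 19) (by norm_num) (by norm_num) (by norm_num)
  norm_num at this ⊢; linarith

/-- **EVEN, row `21/10`**: `0 ≤ ε_ev(21/10)` gives `H_ev(q)` for every prime `q ≤ 59` (`61^5 ≤ e^{21}`). [this track] -/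
theorem forall_even_le_59_of_even_energy_21_10 (hev : 0 ≤ weilEvenGroundEnergy (21 / 10)) :
    ∀ q : ℕ, q.Prime → q ≤ 59 → 0 ≤ weilEvenGroundEnergy (Real.log (nextPrime q) / 2) := by
  intro q _ hqQ
  refine evenSegment_of_even_energy (by norm_num) ?_ hev hqQ
  rw [nextPrime_values'.2]
  have := log_half_le_of_pow_le (P := 61) (k := 5) (m := 21) (by norm_num) (by norm_num) (by norm_num)
  norm_num at this ⊢; linarith

/-- **ODD, row `21/10`**: `0 ≤ ε_od(21/10)` gives `H_od(q)` for every prime `q ≤ 59`. [this track] -/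
theorem forall_odd_le_59_of_odd_energy_21_10 (hod : 0 ≤ weilOddGroundEnergy (21 / 10)) :
    ∀ q : ℕ, q.Prime → q ≤ 59 → 0 ≤ weilOddGroundEnergy (Real.log (nextPrime q) / 2) := by
  intro q _ hqQ
  refine oddSegment_of_odd_energy (by norm_num) ?_ hod hqQ
  rw [nextPrime_values'.2]
  have := log_half_le_of_pow_le (P := 61) (k := 5) (m := 21) (by norm_num) (by norm_num) (by norm_num)
  norm_num at this ⊢; linarith

/-- **TWO WINDOWS, ONE CONCLUSION** (rows 23/29 of PNT-T2 v1.8 rest on the `7/4` AND the `9/5` two-sector cells): either pair of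
sector certificates gives both halves `H_ev(q) ∧ H_od(q)` — hence `H(q)` by `HandoffDecomposition` — for every prime `q ≤ 29`. [this track] -/
theorem forall_sectors_le_29_of_sector_energies_7_4_or_9_5
    (h : (0 ≤ weilEvenGroundEnergy (7 / 4) ∧ 0 ≤ weilOddGroundEnergy (7 / 4)) ∨
      (0 ≤ weilEvenGroundEnergy (9 / 5) ∧ 0 ≤ weilOddGroundEnergy (9 / 5))) :
    ∀ q : ℕ, q.Prime → q ≤ 29 →
      0 ≤ weilEvenGroundEnergy (Real.log (nextPrime q) / 2) ∧ 0 ≤ weilOddGroundEnergy (Real.log (nextPrime q) / 2) := by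
  intro q hq hqQ
  rcases h with ⟨hev, hod⟩ | ⟨hev, hod⟩
  · exact ⟨forall_even_le_29_of_even_energy_7_4 hev q hq hqQ, forall_odd_le_29_of_odd_energy_7_4 hod q hq hqQ⟩
  · exact ⟨forall_even_le_29_of_even_energy_9_5 hev q hq hqQ, forall_odd_le_29_of_odd_energy_9_5 hod q hq hqQ⟩


/-! ## §5 [gen9 append, 2026-08-24] What ONE sector certificate leaves open — the two-sector words given the even cell

Custody sentence of PNT-T2 v1.8 T2.4 «(A, 29 ≤ q ≤ 47): HALF DONE»: once an EVEN N = ∞ bracket `0 ≤ ε_ev(c)` exists at `c ≥ (log Q⁺)/2`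
(today: `ε_ev(19/10) > 0`, `ε_ev(2) > 0`, producer-CLAIMED), the two-sector words «`H(q)` for all primes `q ≤ Q`» are EQUIVALENT to ONE odd
inequality at the window end — the odd cell is the one open object. The per-prime sector split `H(q) ↔ 0 ≤ ε_ev ∧ 0 ≤ ε_od` is XII-s's
`HandoffSectorCriterion.handoffH_iff_even_and_odd` and the downward closure is XII-n's `HandoffLadderRungsWide.forall_handoffH_le_iff`; both
modules are accepted but not yet built on the farm, so their three-line contents are inlined below as `have`s (not restated as theorems). -/

/-- **Given the even cell, `H(q)` is the odd half**: `0 ≤ ε_ev(c)` at `c ≥ (log q⁺)/2` ⟹ (`H(q) ↔ 0 ≤ ε_od((log q⁺)/2)`).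
[cite: Bombieri2000Weil, §4 Problem 2 (p. 194) and Thm 5 (p. 199); this track] -/
theorem handoffH_iff_odd_end_of_even_energy (hq : q.Prime) (hc : Real.log (nextPrime q) / 2 ≤ c)
    (hev : 0 ≤ weilEvenGroundEnergy c) :
    HandoffH q ↔ 0 ≤ weilOddGroundEnergy (Real.log (nextPrime q) / 2) := by
  have h0 := (log_nextPrime_half_pos_and_mono hq le_rfl).1
  have key : HandoffH q ↔ 0 ≤ weilEvenGroundEnergy (Real.log (nextPrime q) / 2) ∧
      0 ≤ weilOddGroundEnergy (Real.log (nextPrime q) / 2) := by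
    rw [handoffH_iff_weilPositivityOn hq, ← weilGroundEnergy_nonneg_iff_holds h0, weilGroundEnergy_eq_min_even_odd, le_min_iff]
  rw [key]
  exact ⟨fun h ↦ h.2, fun h ↦ ⟨evenSegment_of_even_energy hq hc hev le_rfl, h⟩⟩

/-- **Given the odd cell, `H(q)` is the even half** (the twin statement). [this track] -/
theorem handoffH_iff_even_end_of_odd_energy (hq : q.Prime) (hc : Real.log (nextPrime q) / 2 ≤ c)
    (hod : 0 ≤ weilOddGroundEnergy c) :
    HandoffH q ↔ 0 ≤ weilEvenGroundEnergy (Real.log (nextPrime q) / 2) := by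
  have h0 := (log_nextPrime_half_pos_and_mono hq le_rfl).1
  have key : HandoffH q ↔ 0 ≤ weilEvenGroundEnergy (Real.log (nextPrime q) / 2) ∧
      0 ≤ weilOddGroundEnergy (Real.log (nextPrime q) / 2) := by
    rw [handoffH_iff_weilPositivityOn hq, ← weilGroundEnergy_nonneg_iff_holds h0, weilGroundEnergy_eq_min_even_odd, le_min_iff]
  rw [key]
  exact ⟨fun h ↦ h.1, fun h ↦ ⟨h, oddSegment_of_odd_energy hq hc hod le_rfl⟩⟩

/-- **THE ONE OPEN OBJECT**: given an even certificate `0 ≤ ε_ev(c)`, `c ≥ (log Q⁺)/2`, the words «`H(q)` for all primes `q ≤ Q`» are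
equivalent to the single odd inequality `0 ≤ ε_od((log Q⁺)/2)`. [this track] -/
theorem forall_handoffH_le_iff_odd_end_of_even_energy (hQ : Q.Prime) (hc : Real.log (nextPrime Q) / 2 ≤ c)
    (hev : 0 ≤ weilEvenGroundEnergy c) :
    (∀ q : ℕ, q.Prime → q ≤ Q → HandoffH q) ↔ 0 ≤ weilOddGroundEnergy (Real.log (nextPrime Q) / 2) := by
  rw [← handoffH_iff_odd_end_of_even_energy hQ hc hev]
  refine ⟨fun h ↦ h Q hQ le_rfl, fun h q hq hqQ ↦ ?_⟩
  have hodQ := (handoffH_iff_odd_end_of_even_energy hQ hc hev).1 h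
  obtain ⟨_, hm⟩ := log_nextPrime_half_pos_and_mono hQ hqQ
  exact (handoffH_iff_odd_end_of_even_energy hq (hm.trans hc) hev).2 (oddSegment_of_odd_energy hQ le_rfl hodQ hqQ)

/-- The twin: given an odd certificate at `c ≥ (log Q⁺)/2`, the words through `Q` ↔ `0 ≤ ε_ev((log Q⁺)/2)`. [this track] -/
theorem forall_handoffH_le_iff_even_end_of_odd_energy (hQ : Q.Prime) (hc : Real.log (nextPrime Q) / 2 ≤ c)
    (hod : 0 ≤ weilOddGroundEnergy c) :
    (∀ q : ℕ, q.Prime → q ≤ Q → HandoffH q) ↔ 0 ≤ weilEvenGroundEnergy (Real.log (nextPrime Q) / 2) := by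
  rw [← handoffH_iff_even_end_of_odd_energy hQ hc hod]
  refine ⟨fun h ↦ h Q hQ le_rfl, fun h q hq hqQ ↦ ?_⟩
  have hevQ := (handoffH_iff_even_end_of_odd_energy hQ hc hod).1 h
  obtain ⟨_, hm⟩ := log_nextPrime_half_pos_and_mono hQ hqQ
  exact (handoffH_iff_even_end_of_odd_energy hq (hm.trans hc) hod).2 (evenSegment_of_even_energy hQ le_rfl hevQ hqQ)

/-- Instance `t = 2` (the deposited even bracket `ε_ev(2) > 0`): the two-sector words through `47` ↔ `0 ≤ ε_od((log 53)/2)` — ONE odd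
certificate at any `c ≥ (log 53)/2` (e.g. `c = 2`, `53 ≤ e^4`) finishes T2's rows `31 … 47`. [this track] -/
theorem forall_handoffH_le_47_iff_odd_end_of_even_energy_two (hev : 0 ≤ weilEvenGroundEnergy 2) :
    (∀ q : ℕ, q.Prime → q ≤ 47 → HandoffH q) ↔ 0 ≤ weilOddGroundEnergy (Real.log 53 / 2) := by
  have hc : Real.log (nextPrime 47) / 2 ≤ 2 := by
    rw [nextPrime_values.2.2.1]
    have := log_half_le_of_pow_le (P := 53) (k := 1) (m := 4) (by norm_num) (by norm_num) (by norm_num)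
    norm_num at this ⊢; linarith
  have h := forall_handoffH_le_iff_odd_end_of_even_energy (Q := 47) (by norm_num) hc hev
  rw [nextPrime_values.2.2.1] at h
  exact_mod_cast h

/-- Instance `t = 19/10` (even bracket `ε_ev(19/10) > 0`): the words through `41` ↔ `0 ≤ ε_od((log 43)/2)` (`43^5 ≤ e^{19}`). [this track] -/
theorem forall_handoffH_le_41_iff_odd_end_of_even_energy_19_10 (hev : 0 ≤ weilEvenGroundEnergy (19 / 10)) :
    (∀ q : ℕ, q.Prime → q ≤ 41 → HandoffH q) ↔ 0 ≤ weilOddGroundEnergy (Real.log 43 / 2) := by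
  have hc : Real.log (nextPrime 41) / 2 ≤ 19 / 10 := by
    rw [nextPrime_values'.1]
    have := log_half_le_of_pow_le (P := 43) (k := 5) (m := 19) (by norm_num) (by norm_num) (by norm_num)
    norm_num at this ⊢; linarith
  have h := forall_handoffH_le_iff_odd_end_of_even_energy (Q := 41) (by norm_num) hc hev
  rw [nextPrime_values'.1] at h
  exact_mod_cast h

/-- The two-sector row at `t = 2` recovered from the one-sector pieces: `0 ≤ ε_ev(2) ∧ 0 ≤ ε_od(2)` gives the words through `47`
(same primes as `HandoffLadderRungs.forall_handoffH_of_sector_energies_two`, stated with `≤ 47`). [this track] -/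
theorem forall_handoffH_le_47_of_sector_energies_two (hev : 0 ≤ weilEvenGroundEnergy 2) (hod : 0 ≤ weilOddGroundEnergy 2) :
    ∀ q : ℕ, q.Prime → q ≤ 47 → HandoffH q := by
  have h := forall_odd_le_47_of_odd_energy_two hod 47 (by norm_num) le_rfl
  rw [nextPrime_values.2.2.1] at h
  exact (forall_handoffH_le_47_iff_odd_end_of_even_energy_two hev).2 (by exact_mod_cast h)

end Summit.RiemannHypothesis.RiemannHypothesis.Theorems.HandoffSectorLadder

end
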